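import Mathlib
import Summits.ResolutionOfSingularities.ResolutionOfSingularities.Theorems.SyzygyFlatteningDefs
import Summits.ResolutionOfSingularities.ResolutionOfSingularities.Theorems.SyzygyFlatteningHigherRankTerminationTowerStageBasic
import Summits.ResolutionOfSingularities.ResolutionOfSingularities.Theorems.SyzygyFlatteningHigherRankTerminationLocAt
import Summits.ResolutionOfSingularities.ResolutionOfSingularities.Theorems.SyzygyFlatteningHigherRankTerminationTowerLocalisation
import Summits.ResolutionOfSingularities.ResolutionOfSingularities.Theorems.SyzygyFlatteningRankOneTerminationReduction
import Summits.ResolutionOfSingularities.ResolutionOfSingularities.Theorems.SyzygyFlatteningRankOneTerminationStageNormal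
import Literature.AlgebraicGeometry.Resolution.DominatedUnions
import HarnessLib

/-!
# The union dichotomy for the syzygy-flattening tower (`stub_union_dichotomy`)

Crux `SyzygyFlattening.HigherRankTermination` (stmt-ResolutionOfSingularities-17045), line
`birth`, registered glue stub `stub_union_dichotomy`.

Let `k ⊆ O` be a dimension-zero valuation ring of `K`, `A ⊆ O` a finitely generated model with
`Frac A = K`, and `T_m = tower O A m` the syzygy-flattening tower along `O`
(`Theorems/SyzygyFlatteningDefs.lean`). Then EITHER the stages exhaust `O` (every `x ∈ O` lies
in some `T_m`), OR there is a valuation ring `W ≠ O` of `K`, NOT of dimension zero over `k`,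
which contains every stage and has on every stage the same non-units as `O`.

Proof. Suppose `t ∈ O` lies in no stage. Every stage is closed under inverting `O`-units
(`inv_mem_tower_of_inv_mem`: `T_m = locAt O T_m`), so `t⁻¹` lies in no stage either. The
stages `T₁ ⊆ T₂ ⊆ ⋯` are local (`isLocalRing_tower`), integrally closed in `K`
(`stub_stageNormal`, `isFractionRing_tower`) and each is dominated by the next (an element of
`T_{m+1}` inverted in `T_{m+2} ⊆ O` is inverted in `T_{m+1}`). Abhyankar's Lemma 7
(`Literature.….exists_valuationSubring_dominates_of_chain'`) gives a valuation ring `W ∋ t`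
dominating every `T_{m+1}` such that no polynomial `p` over a stage with `w(p(t)) > 0` has a unit
coefficient. A non-zero `f ∈ k[X]` with `w(f(t)) > 0` would, mapped to `T₁[X]`, have its
(non-zero) leading coefficient a unit: so `W` is not of dimension zero over `k`
(`not_dimZero_of_residually_transcendental`), in particular `W ≠ O`. Finally `W` and `O` have
the same non-units on each stage: for `0 ≠ y ∈ T_m ⊆ T_{m+1}`, `y⁻¹ ∈ W` iff `y⁻¹ ∈ O`
(domination one way, closure under `O`-units the other), and `y⁻¹ ∈ O ↔ ¬ O.valuation y < 1`.

References: Abhyankar 1956, Lemma 7 (= Abhyankar 1959, Prop. 4.1); Zariski–Samuel VI §§3, 4.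
-/

noncomputable section

-- single-problem summit: the doubled namespace component `ResolutionOfSingularities` is forced
set_option linter.dupNamespace false

namespace Summit.ResolutionOfSingularities.ResolutionOfSingularities.Theorems.SyzygyFlattening

open Literature.AlgebraicGeometry.Resolution Polynomial

variable {k K : Type} [Field k] [Field K] [Algebra k K]

/-! ## Stages are closed under inverting `O`-units -/

/-- Every stage of the tower is closed under inverting `O`-units: for `s ∈ tower O A m` with
`s⁻¹ ∈ O`, `s⁻¹ ∈ tower O A m` (`s⁻¹ = 1 * s⁻¹ ∈ locAt O (tower O A m) = tower O A m`).
[folklore] -/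
theorem inv_mem_tower_of_inv_mem (O : ValuationSubring K) (A : Subalgebra k K)
    (hk : ∀ c : k, algebraMap k K c ∈ O) (hAO : A.toSubring ≤ O.toSubring) (m : ℕ) {s : K}
    (hs : s ∈ tower O A m) (hsO : s⁻¹ ∈ O) : s⁻¹ ∈ tower O A m := by
  have h := mul_inv_mem_locAt O (tower O A m) (tower O A m).one_mem hs hsO
  rwa [one_mul, locAt_tower O A hk hAO m] at h

/-! ## Non-units of two valuation rings -/

/-- For `s ≠ 0`: `s⁻¹ ∈ O` iff `s` is not an `O`-non-unit (`O.valuation s⁻¹ ≤ 1 ↔ 1 ≤ O.valuation s`).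
[folklore] -/
private theorem inv_mem_iff_not_valuation_lt_one_aux (O : ValuationSubring K) {s : K}
    (hs0 : s ≠ 0) : s⁻¹ ∈ O ↔ ¬ O.valuation s < 1 := by
  -- adapted from `inv_mem_iff_not_valuation_lt_one` (Theorems/…TowerEqOfDominates.lean)
  rw [← O.valuation_le_one_iff, ← Valuation.one_le_val_iff _ hs0, not_lt]

/-- Two valuation rings `O`, `W` of `K` which contain the inverse of `y` simultaneously agree on
whether `y` is a non-unit (`y = 0` is a non-unit of both). [folklore] -/
theorem valuation_lt_one_iff_of_inv_mem_iff (O W : ValuationSubring K) {y : K}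
    (h : y⁻¹ ∈ W ↔ y⁻¹ ∈ O) : W.valuation y < 1 ↔ O.valuation y < 1 := by
  by_cases hy0 : y = 0
  · subst hy0
    simp
  · rw [← not_iff_not, ← inv_mem_iff_not_valuation_lt_one_aux W hy0,
      ← inv_mem_iff_not_valuation_lt_one_aux O hy0]
    exact h

/-! ## Residual transcendence excludes dimension zero -/

/-- If `t ∈ W` and no polynomial `p` over a subring `R ⊇ k` of `K` with `w(p(t)) > 0` has a unit
coefficient, then `W` is not of dimension zero over `k`: a non-zero `f ∈ k[X]` with
`w(f(t)) > 0`, mapped to `R[X]`, has the same value at `t` and its leading coefficient is the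
image of a unit of `k`. [cite: Abhyankar1956Valuations, Lemma 7] -/
theorem not_dimZero_of_residually_transcendental (W : ValuationSubring K) (R : Subring K)
    (hkR : ∀ c : k, algebraMap k K c ∈ R) {t : K} (htW : t ∈ W)
    (hpoly : ∀ p : (↥R)[X], W.valuation (aeval t p) < 1 → ∀ j, ¬ IsUnit (p.coeff j)) :
    ¬ DimZero k W := by
  intro hdz
  obtain ⟨f, hf0, hf⟩ := hdz t htW
  -- the coefficient map `k → R`
  let φ : k →+* ↥R :=
    { toFun := fun c => ⟨algebraMap k K c, hkR c⟩
      map_one' := Subtype.ext (map_one _)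
      map_mul' := fun a b => Subtype.ext (map_mul _ a b)
      map_zero' := Subtype.ext (map_zero _)
      map_add' := fun a b => Subtype.ext (map_add _ a b) }
  have hφ : (algebraMap ↥R K).comp φ = algebraMap k K := RingHom.ext fun _ => rfl
  have heval : aeval t (f.map φ) = aeval t f := by
    rw [aeval_def, eval₂_map, hφ, ← aeval_def]
  have hunit : IsUnit ((f.map φ).coeff f.natDegree) := by
    rw [coeff_map, coeff_natDegree]
    exact (leadingCoeff_ne_zero.mpr hf0).isUnit.map φ
  refine hpoly (f.map φ) ?_ f.natDegree hunit
  rw [heval]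
  exact hf

/-! ## The registered stub -/

/-- **STUB `stub_union_dichotomy` (glue).** Along a dimension-zero `O`, either the tower
EXHAUSTS `O` (every element of `O` lies in some stage), or some valuation ring `W ≠ O` that is
NOT of dimension zero over `k` dominates every stage (contains it, with the same non-units).
Proof: if `t ∈ O` lies in no stage then neither does `t⁻¹` (stages are closed under inverting
`O`-units); the stages `T₁ ⊆ T₂ ⊆ ⋯` are local, integrally closed in `K` (`stub_stageNormal`)
and each dominated by the next, so Abhyankar's Lemma 7 (tree
`exists_valuationSubring_dominates_of_chain'`) gives `W ∋ t` dominating all of them such that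
every polynomial over a stage with `w(p(t)) > 0` has no unit coefficient — so no non-zero
`f ∈ k[X]` has `w(f(t)) > 0`, i.e. `W` is not of dimension zero, and in particular `W ≠ O`.
[cite: Abhyankar1956Valuations, Lemma 7] -/
theorem stub_union_dichotomy : ∀ (k K : Type) [Field k] [Field K] [Algebra k K]
    (O : ValuationSubring K) (A : Subalgebra k K), (∀ c : k, algebraMap k K c ∈ O) → A.FG →
      IsFractionRing ↥A K → A.toSubring ≤ O.toSubring → DimZero k O →
      (∀ x : K, x ∈ O → ∃ m : ℕ, x ∈ tower O A m) ∨
        ∃ W : ValuationSubring K, W ≠ O ∧ ¬ DimZero k W ∧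
          ∀ m : ℕ, (tower O A m).toSubring ≤ W.toSubring ∧
            ∀ y ∈ tower O A m, W.valuation y < 1 ↔ O.valuation y < 1 := by
  intro k K _ _ _ O A hk hFG hFrac hAO halg
  by_cases hU : ∀ x : K, x ∈ O → ∃ m : ℕ, x ∈ tower O A m
  · exact Or.inl hU
  right
  push Not at hU
  obtain ⟨t, htO, ht⟩ := hU
  -- stage facts
  have hTO : ∀ m, (tower O A m).toSubring ≤ O.toSubring := tower_toSubring_le O hk hAO
  have hinv : ∀ m {s : K}, s ∈ tower O A m → s⁻¹ ∈ O → s⁻¹ ∈ tower O A m :=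
    fun m _ hs hsO => inv_mem_tower_of_inv_mem O A hk hAO m hs hsO
  -- the chain of normal local stages `R i = T (i + 1)`
  let R : ℕ → Subring K := fun i => (tower O A (i + 1)).toSubring
  have hloc : ∀ i, IsLocalRing (R i) := fun i => isLocalRing_tower O A hk hAO (i + 1)
  have hdom : ∀ i, SubringDominates (R i) (R (i + 1)) := fun i =>
    ⟨fun x hx => tower_le_tower_succ O A (i + 1) hx,
      fun x hx hxinv => hinv (i + 1) hx (hTO (i + 2) hxinv)⟩
  have hint : ∀ i, IsIntegrallyClosedIn (R i) K := fun i => by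
    haveI : IsIntegrallyClosed (R i) := stub_stageNormal k K O A hk hFG hFrac hAO i
    haveI : IsFractionRing (R i) K := isFractionRing_tower O A hFrac (i + 1)
    exact (isIntegrallyClosed_iff_isIntegrallyClosedIn K).mp ‹_›
  have htR : ∀ i, t ∉ R i := fun i h => ht (i + 1) h
  have htR' : ∀ i, t⁻¹ ∉ R i := fun i h => ht (i + 1) (by
    have h' := hinv (i + 1) h (by rw [inv_inv]; exact htO)
    rwa [inv_inv] at h')
  -- Abhyankar's Lemma 7
  obtain ⟨W, htW, hWdom, hpoly⟩ :=
    exists_valuationSubring_dominates_of_chain' R hloc hdom hint htR htR'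
  have hndz : ¬ DimZero k W :=
    not_dimZero_of_residually_transcendental W (R 0)
      (fun c => self_le_tower O A 1 (A.algebraMap_mem c)) htW (hpoly 0)
  refine ⟨W, ?_, hndz, fun m => ⟨?_, ?_⟩⟩
  · rintro rfl
    exact hndz halg
  · exact fun x hx => (hWdom m).1 (tower_le_tower_succ O A m hx)
  · intro y hy
    have hy' : y ∈ R m := tower_le_tower_succ O A m hy
    exact valuation_lt_one_iff_of_inv_mem_iff O W
      ⟨fun h => hTO (m + 1) ((hWdom m).2 y hy' h), fun h => (hWdom m).1 (hinv (m + 1) hy' h)⟩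

end Summit.ResolutionOfSingularities.ResolutionOfSingularities.Theorems.SyzygyFlattening

end
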